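import Mathlib
import Summits.RiemannHypothesis.RiemannHypothesis.Theses.SpectralTrace
import Literature.NumberTheory.LFunctions.RiemannXi
import Literature.NumberTheory.LFunctions.RiemannXiProofs
import Literature.NumberTheory.LFunctions.LagariasXiShiftHermiteBiehler
import Literature.NumberTheory.LFunctions.LagariasXiShiftHermiteBiehlerProofs

/-!
# Sketch (crux-ideate, stmt-RiemannHypothesis-0187 = `SpectralTrace.SpectralThesis`, ideator k=1, round 1)

Idea `lagarias-fence-continuation`: the cosh-damped / shifted explicit formula.
`A_h(s) = ξ(s+h) + ξ(s-h)`; for `h ≥ 1/2` all zeros of `A_h` are critical (Taylor 1945, Lagarias 2005,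
in tree: `lagarias2005_lemma_2_1_holds`), so the ordinates of the zeros of `A_{1/2}` — the set
`{t : Re ξ(1 + it) = 0}`, the "phase fence of ζ on the 1-line" — are an unconditional REAL unit-multiplicity
family reproducing the damped Weil functional `W_h` (defined by the far-contour integral, analytic in `h`,
`W_0 = W`).  The line: continue in `h` from `1/2` down to `0`, window by window (open–closed argument),
then `WindowCompactness` (proved item 11197) gives X.
-/

noncomputable section

open Complex MeasureTheory Set Filter Topology
open scoped Real ComplexConjugate

namespace Summit.RiemannHypothesis.RiemannHypothesis.Cruxes.SpectralThesis.Ideator1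

open Literature.NumberTheory.LFunctions
open Summit.RiemannHypothesis.RiemannHypothesis.Theses.SpectralTrace

/-- The shifted / cosh-damped xi function `A_h(s) = ξ(s+h) + ξ(s-h)` (Taylor 1945, Lagarias 2005;
Fourier side: kernel `2cosh(hu)Φ(u)`, a de Bruijn universal factor). -/
def shiftedXi (h : ℝ) (s : ℂ) : ℂ :=
  riemannXi (s + h) + riemannXi (s - h)

/-- Functional equation `A_h(1-s) = A_h(s)`. -/
theorem shiftedXi_one_sub (h : ℝ) (s : ℂ) : shiftedXi h (1 - s) = shiftedXi h s := by
  unfold shiftedXi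
  have e1 : (1 : ℂ) - s + h = 1 - (s - h) := by ring
  have e2 : (1 : ℂ) - s - h = 1 - (s + h) := by ring
  rw [e1, e2, riemannXi_one_sub, riemannXi_one_sub, add_comm]

/-- **First lemma (PROVED): the Taylor–Lagarias fence is critical.** Every zero of
`A_{1/2}(s) = ξ(s + 1/2) + ξ(s - 1/2)` lies on `Re s = 1/2` (from the tree's proved Hermite–Biehler
inequality `lagarias2005_lemma_2_1_holds` at `h = 1/2`, Schwarz reflection `riemannXi_conj_holds` and the
functional equation `riemannXi_one_sub`).  On the line, `A_{1/2}(1/2+it) = 2 Re ξ(1+it)`, so the fence is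
`{t : Re ξ(1+it) = 0}` — explicit in terms of `ζ` on the edge `Re s = 1` of the critical strip. -/
theorem fence_critical (s : ℂ) (hs : shiftedXi (1 / 2) s = 0) : s.re = 1 / 2 := by
  -- key step: no zeros with Re s > 1/2
  have key : ∀ w : ℂ, 1 / 2 < w.re → shiftedXi (1 / 2) w ≠ 0 := by
    intro w hw hzero
    have hL := lagarias2005_lemma_2_1_holds (1 / 2) (le_refl _) w hw
    have c1 : (((1 / 2 : ℝ)) : ℂ) + w = w + ((1 / 2 : ℝ) : ℂ) := by ring
    have c2 : conj (1 - (w - ((1 / 2 : ℝ) : ℂ))) = ((1 / 2 : ℝ) : ℂ) + 1 - conj w := by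
      simp only [map_sub, map_one, Complex.conj_ofReal]
      ring
    -- from A(w) = 0: ξ(w + 1/2) = -ξ(w - 1/2)
    have hsum : riemannXi (w + ((1 / 2 : ℝ) : ℂ)) = -riemannXi (w - ((1 / 2 : ℝ) : ℂ)) := by
      have h0 : riemannXi (w + ((1 / 2 : ℝ) : ℂ)) + riemannXi (w - ((1 / 2 : ℝ) : ℂ)) = 0 := hzero
      linear_combination h0
    -- ‖ξ(1/2 + 1 - conj w)‖ = ‖ξ(conj (1 - (w - 1/2)))‖ = ‖ξ(1 - (w - 1/2))‖ = ‖ξ(w - 1/2)‖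
    have hnorm : ‖riemannXi (((1 / 2 : ℝ) : ℂ) + 1 - conj w)‖ = ‖riemannXi (w - ((1 / 2 : ℝ) : ℂ))‖ := by
      rw [← c2, riemannXi_conj_holds, Complex.norm_conj, riemannXi_one_sub]
    rw [c1, hsum, norm_neg, hnorm] at hL
    exact lt_irrefl _ hL
  -- now case on Re s
  rcases lt_trichotomy s.re (1 / 2) with hlt | heq | hgt
  · exfalso
    have h1 : 1 / 2 < (1 - s).re := by simp; linarith
    exact key (1 - s) h1 (by rw [shiftedXi_one_sub]; exact hs)
  · exact heq
  · exact absurd hs (key s hgt)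

/-- The damped Weil functional `W_h(g)`: the far-contour form of "Σ over zeros of `A_h` of `ĝ`",
`W_h(g) = (1/2πi)[∫_{Re s = 2} - ∫_{Re s = -1}] ĝ(s) (A_h'/A_h)(s) ds`.  It is real-analytic in
`h ∈ (-1, 1)` (no zeros of `A_h` on the two lines) and `W_0 = weilFunctional` (the explicit formula in contour
form).  For `h ≥ 1/2` it equals: damped primes `-Σ Λ(n) n^{-1/2-h}(g(log n)+g(-log n))`, a shifted digamma
term, a modified polar term, plus Poisson-aliasing terms in the phase `arg ξ(1/2+h+it)`. -/
def dampedWeil (h : ℝ) (g : ℝ → ℂ) : ℂ :=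
  (1 / (2 * π) : ℂ) * ∫ t : ℝ,
    (weilMellin g (2 + t * I) * (deriv (shiftedXi h) (2 + t * I) / shiftedXi h (2 + t * I))
      - weilMellin g (-1 + t * I) * (deriv (shiftedXi h) (-1 + t * I) / shiftedXi h (-1 + t * I)))

/-- Rung of the damping ladder (same SHAPE as the crux X): a real family reproduces `W_h` on all Weil tests. -/
def DampedTrace (h : ℝ) : Prop :=
  ∃ (ι : Type) (γ : ι → ℝ), ∀ g : ℝ → ℂ, IsWeilTest g →
    HasSum (fun i => weilMellin g (1 / 2 + (γ i : ℂ) * I)) (dampedWeil h g)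

/-- Windowed rung `T(h, A)`: a real family reproduces `W_h` on Weil tests supported in `[-A, A]`. -/
def WindowDampedTrace (h A : ℝ) : Prop :=
  ∃ (ι : Type) (γ : ι → ℝ), ∀ g : ℝ → ℂ, IsWeilTest g → tsupport g ⊆ Set.Icc (-A) A →
    HasSum (fun i => weilMellin g (1 / 2 + (γ i : ℂ) * I)) (dampedWeil h g)

/-- FENCE RUNG (provable, size L): the Taylor–Lagarias fence realises `W_{1/2}` — `fence_critical` plus the
explicit formula (contour shift) for the entire order-1 function `A_{1/2}`. -/
def FenceRung : Prop := DampedTrace (1 / 2)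

/-- `W_0 = W` (provable: contour form of `explicit_formula_holds`; `A_0 = 2ξ`). -/
def DampedAtZero : Prop := ∀ g : ℝ → ℂ, IsWeilTest g → dampedWeil 0 g = weilFunctional g

/-- PATH CLOSEDNESS (provable, size M; same mechanism as the proved `WindowCompactness`, item 11197, run in the
parameter `h` instead of the window: local Weyl bounds from positive tests, Helly, integrality of vague limits,
continuity of `h ↦ W_h(g)`). -/
def PathClosed : Prop :=
  ∀ A : ℝ, 0 < A → IsClosed {h : ℝ | h ∈ Set.Icc (0 : ℝ) (1 / 2) ∧ WindowDampedTrace h A}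

/-- PATH OPENNESS (the crux of the line; RH-implied since every `T(h, A)` is): window-exact real families for
`W_h` continue to `W_{h'}` for `h'` slightly below `h` — uniform right-invertibility of the windowed synthesis
operator `δγ ↦ Σ δγ_i · (it) e^{iγ_i t}|_{(-A,A)}` along the path. -/
def PathOpen : Prop :=
  ∀ A : ℝ, 0 < A → ∀ h ∈ Set.Ioc (0 : ℝ) (1 / 2), WindowDampedTrace h A →
    ∃ δ > 0, ∀ h' ∈ Set.Icc (h - δ) h, 0 ≤ h' → WindowDampedTrace h' A

/-- **Composition (PROVED): fence + closed + open + `W_0 = W` + the proved `WindowCompactness` give the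
crux `SpectralThesis` BY NAME.**  Pure topology of `[0, 1/2]` (infimum of a nonempty closed set that is
"open downwards" must be `0`). -/
theorem spectralThesis_of_continuation (hF : FenceRung) (hC : PathClosed) (hO : PathOpen)
    (hZ : DampedAtZero) (hW : WindowCompactness) : SpectralThesis := by
  apply hW
  intro A hA
  -- the set of good damping parameters for this window
  set S : Set ℝ := {h : ℝ | h ∈ Set.Icc (0 : ℝ) (1 / 2) ∧ WindowDampedTrace h A} with hS
  have hhalf : (1 / 2 : ℝ) ∈ S := by
    refine ⟨⟨by norm_num, le_refl _⟩, ?_⟩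
    obtain ⟨ι, γ, hγ⟩ := hF
    exact ⟨ι, γ, fun g hg _ => hγ g hg⟩
  have hne : S.Nonempty := ⟨_, hhalf⟩
  have hbdd : BddBelow S := ⟨0, fun h hh => hh.1.1⟩
  have hclosed : IsClosed S := hC A hA
  set h₀ := sInf S with hh₀
  have hmem : h₀ ∈ S := hclosed.csInf_mem hne hbdd
  have h0S : (0 : ℝ) ∈ S := by
    by_contra h0
    have hpos : 0 < h₀ := lt_of_le_of_ne hmem.1.1 (fun h => h0 (h ▸ hmem))
    obtain ⟨δ, hδ, hcont⟩ := hO A hA h₀ ⟨hpos, hmem.1.2⟩ hmem.2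
    -- the point h' = max 0 (h₀ - δ) is in S and below h₀
    set h' := max 0 (h₀ - δ) with hh'
    have h'lt : h' < h₀ := max_lt hpos (by linarith)
    have h'mem : h' ∈ S := by
      refine ⟨⟨le_max_left _ _, le_trans h'lt.le hmem.1.2⟩, ?_⟩
      exact hcont h' ⟨le_max_right _ _, h'lt.le⟩ (le_max_left _ _)
    have : h₀ ≤ h' := csInf_le hbdd h'mem
    linarith
  obtain ⟨ι, γ, hγ⟩ := h0S.2
  exact ⟨ι, γ, fun g hg hsupp => (hZ g hg) ▸ hγ g hg hsupp⟩

end Summit.RiemannHypothesis.RiemannHypothesis.Cruxes.SpectralThesis.Ideator1
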